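import Mathlib
import Summits.AnomalousDissipation.AnomalousDissipation.Theorems.SoloBlindGPNondegenerate

/-!
# Marginality principle for positive steady patterns (discrete)

Solo-blind programme, steady door R4c, paper §24.19 ("tuning rigidity of the band").

In the reduced (Gross–Pitaevskii / Thomas–Fermi class) model the squared amplitude profile of the
steady 3D pattern across the leaves is `q = A²` where `A > 0` solves `ε² ΔA + W·A = 0`, `W` being the
local growth-rate surplus of the leaf (bare exponent minus damping minus the mean-flow detuning).
Because `A` is POSITIVE it is the ground state of the Schrödinger operator `ε²Δ + W`, and the
discrete ground-state (Doob) identity of `SoloBlindGPNondegenerate` turns this into two-sided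
information on `W` that does not depend on how the detuning is produced:

* `marginality_form`      : `Σ Wᵢ φᵢ² ≤ ε² Σ (φᵢ₊₁ − φᵢ)²` for every test profile `φ`;
* `marginality_pointwise` : hence `Wᵢ ≤ 4ε²` at EVERY leaf — no leaf of a positive steady pattern is
  more than `4ε²` supercritical, whether or not it carries amplitude;
* `weighted_surplus_eq` / `_nonneg` / `exists_surplus_nonneg` : `Σ Wᵢ Aᵢ² = ε² Σ (Aᵢ₊₁ − Aᵢ)² ≥ 0`,
  so some leaf is (weakly) supercritical;
* `band_detuning`         : writing `W = S − R` (bare surplus minus response), every leaf of the band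
  `{S ≥ η}` is detuned by at least `η − 4ε²`;
* `mass_floor_of_bounded_kernel` : if the detuning per unit Reynolds-stress mass is bounded,
  `Rᵢ ≤ τ Σ qⱼ`, the mass has the floor `Σ qⱼ ≥ (η − 4ε²)/τ`.

The last item isolates the only way the dissipation floor can fail inside the reduced model: a
detuning-per-unit-mass that is unbounded along the sequence (the `ν^{1/3}` contact layers); §24.19
argues that such configurations cannot keep the whole band marginal.  Finite-dimensional algebra only.
-/

namespace Summit.AnomalousDissipation.AnomalousDissipation.Theorems

open Matrix Finset

/-- Discrete Dirichlet identity on the cycle: `Σ φᵢ Δφᵢ = −Σ (φᵢ₊₁ − φᵢ)²`. -/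
theorem sum_mul_lapZ_eq {N : ℕ} [NeZero N] (φ : ZMod N → ℝ) :
    ∑ i, φ i * lapZ φ i = -∑ i, (φ (i + 1) - φ i) ^ 2 := by
  set f : ZMod N → ℝ := fun i => φ i * φ (i + 1) - φ i ^ 2 with hf
  set g : ZMod N → ℝ := fun i => φ (i + 1) * φ i - φ (i + 1) ^ 2 with hg
  have hterm : ∀ i, φ i * lapZ φ i = f i + g (i - 1) := by
    intro i
    simp only [hf, hg, lapZ, sub_add_cancel]
    ring
  have hedge : ∀ i, -((φ (i + 1) - φ i) ^ 2) = f i + g i := by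
    intro i
    simp only [hf, hg]
    ring
  rw [Finset.sum_congr rfl (fun i _ => hterm i), ← Finset.sum_neg_distrib,
    Finset.sum_congr rfl (fun i _ => hedge i), Finset.sum_add_distrib, Finset.sum_add_distrib]
  congr 1
  exact Fintype.sum_equiv (Equiv.subRight (1 : ZMod N)) _ _ (fun i => rfl)

/-- Shift invariance of a sum of squares on the cycle. -/
theorem sum_sq_succ_eq {N : ℕ} [NeZero N] (φ : ZMod N → ℝ) :
    ∑ i, φ (i + 1) ^ 2 = ∑ i, φ i ^ 2 :=
  Fintype.sum_equiv (Equiv.addRight (1 : ZMod N)) _ _ (fun _ => rfl)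

/-- Crude bound on the discrete Dirichlet energy: `Σ (φᵢ₊₁ − φᵢ)² ≤ 4 Σ φᵢ²`. -/
theorem dirichlet_le_four_mass {N : ℕ} [NeZero N] (φ : ZMod N → ℝ) :
    ∑ i, (φ (i + 1) - φ i) ^ 2 ≤ 4 * ∑ i, φ i ^ 2 := by
  have h : ∀ i ∈ (Finset.univ : Finset (ZMod N)),
      (φ (i + 1) - φ i) ^ 2 ≤ 2 * φ (i + 1) ^ 2 + 2 * φ i ^ 2 := by
    intro i _
    nlinarith [sq_nonneg (φ (i + 1) + φ i)]
  calc ∑ i, (φ (i + 1) - φ i) ^ 2 ≤ ∑ i, (2 * φ (i + 1) ^ 2 + 2 * φ i ^ 2) := Finset.sum_le_sum h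
    _ = 2 * ∑ i, φ (i + 1) ^ 2 + 2 * ∑ i, φ i ^ 2 := by
        rw [Finset.sum_add_distrib, Finset.mul_sum, Finset.mul_sum]
    _ = 4 * ∑ i, φ i ^ 2 := by rw [sum_sq_succ_eq]; ring

/-- **Marginality form.** If `A > 0` solves `ε² ΔA + W A = 0` then for every test profile `φ`,
`Σ Wᵢ φᵢ² ≤ ε² Σ (φᵢ₊₁ − φᵢ)²` (the quadratic form of `ε²Δ + W` is nonpositive). -/
theorem marginality_form {N : ℕ} [NeZero N] (A W : ZMod N → ℝ) (ε : ℝ) (hA : ∀ i, 0 < A i)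
    (heq : ∀ i, ε ^ 2 * lapZ A i + W i * A i = 0) (φ : ZMod N → ℝ) :
    ∑ i, W i * φ i ^ 2 ≤ ε ^ 2 * ∑ i, (φ (i + 1) - φ i) ^ 2 := by
  have hW : ∀ i, W i = -(ε ^ 2 * (lapZ A i / A i)) := by
    intro i
    have h := heq i
    have ha := (hA i).ne'
    field_simp
    linarith [h]
  have hG := groundState_form_nonpos A φ hA ε
  have hrw : ∑ i, φ i * (ε ^ 2 * lapZ φ i - ε ^ 2 * (lapZ A i / A i) * φ i)
      = ε ^ 2 * ∑ i, φ i * lapZ φ i + ∑ i, W i * φ i ^ 2 := by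
    rw [Finset.mul_sum, ← Finset.sum_add_distrib]
    exact Finset.sum_congr rfl (fun i _ => by rw [hW i]; ring)
  rw [hrw, sum_mul_lapZ_eq] at hG
  linarith

/-- **Marginality, pointwise.** No leaf of a positive steady pattern is more than `4ε²`
supercritical: `Wᵢ ≤ 4ε²` for every `i`. -/
theorem marginality_pointwise {N : ℕ} [NeZero N] (A W : ZMod N → ℝ) (ε : ℝ) (hA : ∀ i, 0 < A i)
    (heq : ∀ i, ε ^ 2 * lapZ A i + W i * A i = 0) (i : ZMod N) : W i ≤ 4 * ε ^ 2 := by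
  set φ : ZMod N → ℝ := fun j => if j = i then 1 else 0 with hφ
  have h1 := marginality_form A W ε hA heq φ
  have h2 := dirichlet_le_four_mass φ
  have hmass : ∑ j, φ j ^ 2 = 1 := by
    simp only [hφ]
    rw [Finset.sum_eq_single i]
    · simp
    · intro j _ hj; simp [hj]
    · intro h; exact absurd (Finset.mem_univ i) h
  have hWφ : ∑ j, W j * φ j ^ 2 = W i := by
    simp only [hφ]
    rw [Finset.sum_eq_single i]
    · simp
    · intro j _ hj; simp [hj]
    · intro h; exact absurd (Finset.mem_univ i) h
  rw [hWφ] at h1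
  rw [hmass] at h2
  nlinarith [sq_nonneg ε]

/-- **Weighted surplus identity.** `Σ Wᵢ Aᵢ² = ε² Σ (Aᵢ₊₁ − Aᵢ)²` (the `q`-weighted surplus is the
quantum-pressure energy). -/
theorem weighted_surplus_eq {N : ℕ} [NeZero N] (A W : ZMod N → ℝ) (ε : ℝ)
    (heq : ∀ i, ε ^ 2 * lapZ A i + W i * A i = 0) :
    ∑ i, W i * A i ^ 2 = ε ^ 2 * ∑ i, (A (i + 1) - A i) ^ 2 := by
  have h : ∀ i, W i * A i ^ 2 = -(ε ^ 2) * (A i * lapZ A i) := by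
    intro i
    have h3 : W i * A i = -(ε ^ 2 * lapZ A i) := by linarith [heq i]
    have h2 : W i * A i ^ 2 = (W i * A i) * A i := by ring
    rw [h2, h3]
    ring
  rw [Finset.sum_congr rfl (fun i _ => h i), ← Finset.mul_sum, sum_mul_lapZ_eq]
  ring

/-- The `q`-weighted surplus is nonnegative. -/
theorem weighted_surplus_nonneg {N : ℕ} [NeZero N] (A W : ZMod N → ℝ) (ε : ℝ)
    (heq : ∀ i, ε ^ 2 * lapZ A i + W i * A i = 0) : 0 ≤ ∑ i, W i * A i ^ 2 := by
  rw [weighted_surplus_eq A W ε heq]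
  exact mul_nonneg (sq_nonneg ε) (Finset.sum_nonneg fun i _ => sq_nonneg _)

/-- Some leaf of a positive steady pattern is (weakly) supercritical. -/
theorem exists_surplus_nonneg {N : ℕ} [NeZero N] (A W : ZMod N → ℝ) (ε : ℝ) (hA : ∀ i, 0 < A i)
    (heq : ∀ i, ε ^ 2 * lapZ A i + W i * A i = 0) : ∃ i, 0 ≤ W i := by
  by_contra h
  push Not at h
  have hneg : ∑ i, W i * A i ^ 2 < ∑ _i : ZMod N, (0 : ℝ) := by
    apply Finset.sum_lt_sum_of_nonempty Finset.univ_nonempty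
    intro i _
    exact mul_neg_of_neg_of_pos (h i) (pow_pos (hA i) 2)
  have h0 := weighted_surplus_nonneg A W ε heq
  simp at hneg
  linarith

/-- **Band detuning.** Split the surplus as bare surplus minus response, `W = S − R`.  On the band
`{S ≥ η}` every leaf is detuned by at least `η − 4ε²`. -/
theorem band_detuning {N : ℕ} [NeZero N] (A S R : ZMod N → ℝ) (ε η : ℝ) (hA : ∀ i, 0 < A i)
    (heq : ∀ i, ε ^ 2 * lapZ A i + (S i - R i) * A i = 0) (i : ZMod N) (hi : η ≤ S i) :
    η - 4 * ε ^ 2 ≤ R i := by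
  have h := marginality_pointwise A (fun j => S j - R j) ε hA heq i
  linarith

/-- **Mass floor for a bounded response kernel.** If the detuning of every leaf is at most `τ` times
the total Reynolds-stress mass `Σ qⱼ` and some leaf has bare surplus `≥ η`, then the mass is at least
`(η − 4ε²)/τ`.  The floor can therefore only fail through a detuning-per-unit-mass that is unbounded
along the sequence. -/
theorem mass_floor_of_bounded_kernel {N : ℕ} [NeZero N] (A S R q : ZMod N → ℝ) (ε η τ : ℝ)
    (hA : ∀ i, 0 < A i) (heq : ∀ i, ε ^ 2 * lapZ A i + (S i - R i) * A i = 0)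
    (hτ : 0 < τ) (hR : ∀ i, R i ≤ τ * ∑ j, q j) (i₀ : ZMod N) (hi₀ : η ≤ S i₀) :
    (η - 4 * ε ^ 2) / τ ≤ ∑ j, q j := by
  have h1 := band_detuning A S R ε η hA heq i₀ hi₀
  have h2 := hR i₀
  rw [div_le_iff₀ hτ]
  linarith [mul_comm τ (∑ j, q j)]

end Summit.AnomalousDissipation.AnomalousDissipation.Theorems
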